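import Mathlib
import Summits.ValiantsHypothesis.ValiantsHypothesis.Theses.ValuativeGCT
import Summits.ValiantsHypothesis.ValiantsHypothesis.Theorems.ValuativeGCTValuativeFlipIsotypicSliceTools

/-!
# Isotypic slice bound, binomial form, part 1: exact monomial counts per row slot

Det side of crux `ValuativeGCT.ValuativeFlip` (stmt-ValiantsHypothesis-12624; wall-breaker axis
"det-orbit-closure multiplicity bounds for detCensus").  The landed isotypic slice bound
(`…IsotypicSliceTools` / `…IsotypicSliceBound`, `iso_core`) restricts row-wise unimodular sandwich
invariants that are `B`-semi-invariant of weight `χ` injectively and torus-equivariantly to the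
split-scalar Krylov slice, and then counts slice monomials of row weight `d = -χ` by injecting their
exponent vectors into a BOX (every exponent `≤` the row weight of its slot), which gives
`(d j₁ + 1)^(N+1) · ∏_{j free} (d j + 1)^(N²)`.

Here the box is replaced by the EXACT count: an exponent vector of row weight `d` is the family of
its restrictions to the slots, and the restriction to slot `j` is a degree-`d j` exponent vector on
the `n_j` variables of that slot — `C(n_j + d j - 1, d j)` of them (stars and bars,
`Finset.card_finsuppAntidiag_nat_eq_choose`).  With `n_{j₀} = 1` (the scalar `u₀`), `n_{j₁} = N + 1`
(`u₁` and the last column) and `n_j = N²` for a free kept slot this gives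

  `dim W ≤ C(d j₁ + N, N) · ∏_{j free} C(d j + N² - 1, N² - 1)`        (`isoc_core`)

for every space `W` of degree-`D` sandwich invariants supported on the kept slots and semi-invariant
of weight `χ` — polynomial of degree `N` (not `N + 1`) in `d j₁` and of degree `N² - 1` in each
further row weight, and, for SMALL row weights, polynomial in `N`: `C(d + N² - 1, N² - 1) ≤ N^(2d)`
against the box factor `(d + 1)^(N²) ≥ 2^(N²)`.  Part 2 (`…IsotypicBinomialBound`) states the bound
in the crux's currencies.

* `isoc_weight_apply_eq_sum_fiber`, `isoc_filter_mem`, `isoc_restrict_injective`,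
  `isoc_natCard_le` — the general count: for any slot map `slot : V → ι` on finitely many
  variables, the exponent vectors of row weight `d` number at most `∏_j C(n_j + d j - 1, d j)`;
  `isoc_finrank_le` — hence so does the dimension of any space of polynomials of row weight `d`;
* `isoc_card_fiber_*` — the slot sizes of the split-scalar slice `isoVar`;
* `isoc_prod_le` — bookkeeping: the product over all slots is at most the displayed closed form;
* `isoc_core` — the binomial form of `iso_core`.

Elementary over part 1 of the isotypic slice bound (Zariski density and torus equivariance are
imported); no named facts, no new objects of the route.
-/

set_option linter.dupNamespace false

namespace Summit.ValiantsHypothesis.ValiantsHypothesis.Theorems.ValuativeFlip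

open MvPolynomial
open scoped BigOperators Matrix
open Literature.NumberTheory.DiophantineGeometry
open Summit.ValiantsHypothesis.ValiantsHypothesis.Theorems.CutBitesAdjugate

noncomputable section

/-! ## The general count: exponent vectors of a fixed row weight -/

section Count

variable {V ι : Type*} [Fintype V] [DecidableEq V] [Fintype ι] [DecidableEq ι] (slot : V → ι)

omit [DecidableEq V] [Fintype ι] in
/-- The row weight of an exponent vector at a slot `j` is the sum of its exponents over the
variables of slot `j` (sum over the whole fibre, as a finset of variables). [folklore] -/
theorem isoc_weight_apply_eq_sum_fiber (e : V →₀ ℕ) (j : ι) :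
    Finsupp.weight (fun v => (Pi.single (slot v) (1 : ℤ) : ι → ℤ)) e j =
      ((∑ v ∈ Finset.univ.filter (fun v => slot v = j), e v : ℕ) : ℤ) := by
  rw [iso_weight_apply]
  congr 1
  rw [Finset.sum_filter, Finset.sum_filter]
  exact Finset.sum_subset (Finset.subset_univ _) fun v _ hv => by
    rw [Finsupp.notMem_support_iff.mp hv, ite_self]

omit [Fintype ι] in
/-- The restriction of an exponent vector of row weight `d` to the variables of slot `j` is a
degree-`d j` exponent vector supported on that slot. [folklore] -/
theorem isoc_filter_mem (d : ι → ℤ) {e : V →₀ ℕ}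
    (he : Finsupp.weight (fun v => (Pi.single (slot v) (1 : ℤ) : ι → ℤ)) e = d) (j : ι) :
    e.filter (fun v => slot v = j) ∈
      (Finset.univ.filter (fun v => slot v = j)).finsuppAntidiag (d j).toNat := by
  rw [Finset.mem_finsuppAntidiag]
  constructor
  · have h := isoc_weight_apply_eq_sum_fiber slot e j
    rw [he] at h
    have h' : (d j).toNat = ∑ v ∈ Finset.univ.filter (fun v => slot v = j), e v := by
      rw [h, Int.toNat_natCast]
    rw [h']
    refine Finset.sum_congr rfl fun v hv => ?_
    rw [Finsupp.filter_apply_pos]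
    exact (Finset.mem_filter.mp hv).2
  · intro v hv
    rw [Finsupp.support_filter, Finset.mem_filter] at hv
    exact Finset.mem_filter.mpr ⟨Finset.mem_univ _, hv.2⟩

omit [Fintype ι] in
/-- An exponent vector of row weight `d` is determined by its restrictions to the slots: the
restriction map into the product of the per-slot antidiagonals is injective. [folklore] -/
theorem isoc_restrict_injective (d : ι → ℤ) :
    Function.Injective (fun (e : {e : V →₀ ℕ //
        Finsupp.weight (fun v => (Pi.single (slot v) (1 : ℤ) : ι → ℤ)) e = d}) (j : ι) =>
      (⟨e.1.filter (fun v => slot v = j), isoc_filter_mem slot d e.2 j⟩ :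
        ↥((Finset.univ.filter (fun v => slot v = j)).finsuppAntidiag (d j).toNat))) := by
  intro e e' h
  apply Subtype.ext
  ext v
  have hv := congrArg (fun F => ((F (slot v) : ↥((Finset.univ.filter
    (fun v' => slot v' = slot v)).finsuppAntidiag (d (slot v)).toNat)) : V →₀ ℕ) v) h
  simpa [Finsupp.filter_apply] using hv

omit [DecidableEq V] in
/-- **Stars and bars per slot.** The exponent vectors of row weight `d` number at most
`∏_j C(n_j + d j - 1, d j)`, `n_j` the number of variables of slot `j`. [folklore] -/
theorem isoc_natCard_le (d : ι → ℤ) :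
    Nat.card {e : V →₀ ℕ // Finsupp.weight (fun v => (Pi.single (slot v) (1 : ℤ) : ι → ℤ)) e = d} ≤
      ∏ j, ((Finset.univ.filter (fun v => slot v = j)).card + (d j).toNat - 1).choose (d j).toNat := by
  classical
  refine (Nat.card_le_card_of_injective _ (isoc_restrict_injective slot d)).trans (le_of_eq ?_)
  rw [Nat.card_eq_fintype_card, Fintype.card_pi]
  refine Finset.prod_congr rfl fun j _ => ?_
  rw [Fintype.card_coe, Finset.card_finsuppAntidiag_nat_eq_choose]

omit [DecidableEq V] in
/-- The exponent vectors of a fixed row weight form a finite type. [folklore] -/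
theorem isoc_finite (d : ι → ℤ) :
    Finite {e : V →₀ ℕ // Finsupp.weight (fun v => (Pi.single (slot v) (1 : ℤ) : ι → ℤ)) e = d} := by
  classical
  exact Finite.of_injective _ (isoc_restrict_injective slot d)

omit [DecidableEq V] in
/-- **Relative count, binomial form.** A finite-dimensional space of polynomials all of row weight
`d` has dimension at most `∏_j C(n_j + d j - 1, d j)` (it is spanned by the monomials of row
weight `d`). [folklore] -/
theorem isoc_finrank_le {K : Type*} [Field K] (d : ι → ℤ) (W : Submodule K (MvPolynomial V K))
    [Module.Finite K W]
    (hW : W ≤ weightedHomogeneousSubmodule K (fun v => (Pi.single (slot v) (1 : ℤ) : ι → ℤ)) d) :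
    Module.finrank K ↥W ≤
      ∏ j, ((Finset.univ.filter (fun v => slot v = j)).card + (d j).toNat - 1).choose (d j).toNat := by
  classical
  set w₂ : V → ι → ℤ := fun v => Pi.single (slot v) (1 : ℤ) with hw₂
  let E : Type _ := {e : V →₀ ℕ // Finsupp.weight w₂ e = d}
  haveI : Finite E := isoc_finite slot d
  letI : Fintype E := Fintype.ofFinite E
  let b : E → MvPolynomial V K := fun e => monomial e.1 1
  have hle : weightedHomogeneousSubmodule K w₂ d ≤ Submodule.span K (Set.range b) := by
    intro φ hφ
    rw [mem_weightedHomogeneousSubmodule] at hφ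
    rw [φ.as_sum]
    refine Submodule.sum_mem _ fun s hs => ?_
    have hsd : Finsupp.weight w₂ s = d := hφ (mem_support_iff.mp hs)
    have : monomial s (coeff s φ) = coeff s φ • b ⟨s, hsd⟩ := by
      rw [smul_monomial, smul_eq_mul, mul_one]
    rw [this]
    exact Submodule.smul_mem _ _ (Submodule.subset_span (Set.mem_range_self _))
  haveI : Module.Finite K (Submodule.span K (Set.range b)) :=
    Module.Finite.iff_fg.mpr (Submodule.fg_span (Set.finite_range b))
  calc Module.finrank K ↥W
      ≤ Module.finrank K (Submodule.span K (Set.range b)) := Submodule.finrank_mono (hW.trans hle)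
    _ ≤ Fintype.card E := finrank_range_le_card b
    _ = Nat.card E := Nat.card_eq_fintype_card.symm
    _ ≤ _ := isoc_natCard_le slot d

end Count

/-! ## The slot sizes of the split-scalar slice -/

section Slice

variable (t : ℕ)
variable (S : Set (MatIdx (t + 2))) (j₀ j₁ : MatIdx (t + 2)) [DecidablePred (· ∈ S)]

variable {S j₀ j₁} in
/-- Slot `j₁` of the split-scalar slice has at most `N + 1` variables (`u₁` and the last column).
[folklore] -/
theorem isoc_card_fiber_j₁_le (h01 : j₀ ≠ j₁) :
    (Finset.univ.filter (fun v : isoVar t S j₀ j₁ => isoSlot t S j₀ j₁ v = j₁)).card ≤ t + 3 := by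
  classical
  let f : isoVar t S j₀ j₁ → Option (Fin (t + 2)) :=
    Sum.elim (fun _ => none) (Sum.elim (fun a => some a) (fun _ => none))
  have hslot : ∀ v : isoVar t S j₀ j₁, isoSlot t S j₀ j₁ v = j₁ →
      v = Sum.inl true ∨ ∃ a, v = Sum.inr (Sum.inl a) := by
    intro v hv
    rcases v with (_ | _) | (a | q)
    · exact absurd hv (by simp only [isoSlot]; exact h01)
    · exact Or.inl rfl
    · exact Or.inr ⟨a, rfl⟩
    · simp only [isoSlot] at hv
      exact absurd (Or.inr hv) q.2.2
  have h := Finset.card_le_card_of_injOn (s := Finset.univ.filter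
      (fun v : isoVar t S j₀ j₁ => isoSlot t S j₀ j₁ v = j₁)) (t := Finset.univ) f
    (fun v _ => Finset.mem_coe.mpr (Finset.mem_univ (f v))) ?_
  · simpa only [Finset.card_univ, Fintype.card_option, Fintype.card_fin] using h
  · intro v hv v' hv' hvv'
    have hv1 := hslot v (Finset.mem_filter.mp (Finset.mem_coe.mp hv)).2
    have hv1' := hslot v' (Finset.mem_filter.mp (Finset.mem_coe.mp hv')).2
    rcases hv1 with rfl | ⟨a, rfl⟩ <;> rcases hv1' with rfl | ⟨a', rfl⟩
    · rfl
    · simp [f] at hvv'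
    · simp [f] at hvv'
    · simp only [f, Sum.elim_inr, Sum.elim_inl, Option.some.injEq] at hvv'
      rw [hvv']

variable {S j₀ j₁} in
/-- A free kept slot `j ∉ {j₀, j₁}` of the slice has at most `N²` variables (its entries).
[folklore] -/
theorem isoc_card_fiber_free_le (j : MatIdx (t + 2)) (hj : ¬(j = j₀ ∨ j = j₁)) :
    (Finset.univ.filter (fun v : isoVar t S j₀ j₁ => isoSlot t S j₀ j₁ v = j)).card ≤
      (t + 2) * (t + 2) := by
  classical
  let f : isoVar t S j₀ j₁ → MatIdx (t + 2) :=
    Sum.elim (fun _ => j) (Sum.elim (fun _ => j) (fun q => q.1.2))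
  have hslot : ∀ v : isoVar t S j₀ j₁, isoSlot t S j₀ j₁ v = j →
      ∃ q : {p : MatIdx (t + 2) × MatIdx (t + 2) // p.1 ∈ S ∧ ¬(p.1 = j₀ ∨ p.1 = j₁)},
        v = Sum.inr (Sum.inr q) ∧ q.1.1 = j := by
    intro v hv
    rcases v with (_ | _) | (a | q)
    · exact absurd hv (by simp only [isoSlot]; exact fun h => hj (Or.inl h.symm))
    · exact absurd hv (by simp only [isoSlot]; exact fun h => hj (Or.inr h.symm))
    · exact absurd hv (by simp only [isoSlot]; exact fun h => hj (Or.inr h.symm))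
    · exact ⟨q, rfl, by simpa only [isoSlot] using hv⟩
  have h := Finset.card_le_card_of_injOn (s := Finset.univ.filter
      (fun v : isoVar t S j₀ j₁ => isoSlot t S j₀ j₁ v = j)) (t := Finset.univ) f
    (fun v _ => Finset.mem_coe.mpr (Finset.mem_univ (f v))) ?_
  · simpa only [Finset.card_univ, Fintype.card_lex, Fintype.card_prod, Fintype.card_fin] using h
  · intro v hv v' hv' hvv'
    obtain ⟨q, rfl, hq⟩ := hslot v (Finset.mem_filter.mp (Finset.mem_coe.mp hv)).2
    obtain ⟨q', rfl, hq'⟩ := hslot v' (Finset.mem_filter.mp (Finset.mem_coe.mp hv')).2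
    have h2 : q.1.2 = q'.1.2 := by simpa only [f, Sum.elim_inr] using hvv'
    have h1 : q.1.1 = q'.1.1 := by rw [hq, hq']
    rw [show q = q' from Subtype.ext (Prod.ext h1 h2)]

variable {S j₀ j₁} in
/-- Slot `j₀` of the slice has at most one variable (`u₀`). [folklore] -/
theorem isoc_card_fiber_j₀_le (h01 : j₀ ≠ j₁) :
    (Finset.univ.filter (fun v : isoVar t S j₀ j₁ => isoSlot t S j₀ j₁ v = j₀)).card ≤ 1 := by
  rw [Finset.card_le_one]
  intro v hv v' hv'
  rw [(isoSlot_eq_iff t h01 v).mp (Finset.mem_filter.mp hv).2,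
    (isoSlot_eq_iff t h01 v').mp (Finset.mem_filter.mp hv').2]

variable {S j₀ j₁} in
/-- A slot that is neither `j₀`, `j₁` nor a kept slot has no variables. [folklore] -/
theorem isoc_card_fiber_other (j : MatIdx (t + 2)) (hj : ¬(j = j₀ ∨ j = j₁)) (hjS : j ∉ S) :
    (Finset.univ.filter (fun v : isoVar t S j₀ j₁ => isoSlot t S j₀ j₁ v = j)).card = 0 := by
  rw [Finset.card_eq_zero, Finset.filter_eq_empty_iff]
  intro v _
  rcases v with (_ | _) | (a | q)
  · simp only [isoSlot]; exact fun h => hj (Or.inl h.symm)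
  · simp only [isoSlot]; exact fun h => hj (Or.inr h.symm)
  · simp only [isoSlot]; exact fun h => hj (Or.inr h.symm)
  · simp only [isoSlot]
    intro h
    exact hjS (h ▸ q.2.1)

/-- Monotonicity of the stars-and-bars count in the number of variables, in the form used below:
`n ≤ B + 1` gives `C(n + k - 1, k) ≤ C(k + B, B)`. [folklore] -/
theorem isoc_choose_le_of_card_le {n B k : ℕ} (h : n ≤ B + 1) :
    (n + k - 1).choose k ≤ (k + B).choose B := by
  have h1 : (n + k - 1).choose k ≤ (B + 1 + k - 1).choose k :=
    Nat.choose_le_choose k (Nat.sub_le_sub_right (Nat.add_le_add_right h k) 1)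
  have h2 : B + 1 + k - 1 = k + B := by omega
  rw [h2, Nat.choose_symm_add] at h1
  exact h1

variable {S j₀ j₁} in
/-- Per-slot bound: slot `j₁` contributes at most `C(d j₁ + N, N)`, a free kept slot `j` at most
`C(d j + N² - 1, N² - 1)`, and slot `j₀` and the empty slots at most `1`. [folklore] -/
theorem isoc_factor_le (h01 : j₀ ≠ j₁) (d : MatIdx (t + 2) → ℤ) (j : MatIdx (t + 2)) :
    ((Finset.univ.filter (fun v : isoVar t S j₀ j₁ => isoSlot t S j₀ j₁ v = j)).card +
        (d j).toNat - 1).choose (d j).toNat ≤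
      (if j = j₁ then ((d j₁).toNat + (t + 2)).choose (t + 2) else 1) *
        (if (j ∈ S ∧ ¬(j = j₀ ∨ j = j₁)) then
          ((d j).toNat + ((t + 2) * (t + 2) - 1)).choose ((t + 2) * (t + 2) - 1) else 1) := by
  by_cases hj1 : j = j₁
  · rw [if_pos hj1, if_neg (fun h => h.2 (Or.inr hj1)), mul_one, hj1]
    exact isoc_choose_le_of_card_le (isoc_card_fiber_j₁_le t (S := S) h01)
  · rw [if_neg hj1, one_mul]
    by_cases hfree : j ∈ S ∧ ¬(j = j₀ ∨ j = j₁)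
    · rw [if_pos hfree]
      have hM4 : 4 ≤ (t + 2) * (t + 2) := by nlinarith
      have hc := isoc_card_fiber_free_le t (S := S) j hfree.2
      refine isoc_choose_le_of_card_le (hc.trans ?_)
      generalize (t + 2) * (t + 2) = M at hM4 ⊢
      omega
    · rw [if_neg hfree]
      have hc : (Finset.univ.filter
          (fun v : isoVar t S j₀ j₁ => isoSlot t S j₀ j₁ v = j)).card ≤ 0 + 1 := by
        by_cases hj0 : j = j₀
        · rw [hj0]
          exact isoc_card_fiber_j₀_le t h01
        · have hjS : j ∉ S := fun h => hfree ⟨h, not_or.mpr ⟨hj0, hj1⟩⟩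
          rw [isoc_card_fiber_other t j (not_or.mpr ⟨hj0, hj1⟩) hjS]
          exact Nat.zero_le _
      have h := isoc_choose_le_of_card_le (k := (d j).toNat) hc
      rw [Nat.choose_zero_right] at h
      exact h

variable {S j₀ j₁} in
/-- **Bookkeeping.** The product of the per-slot counts over all slots of the split-scalar slice
is at most `C(d j₁ + N, N) · ∏_{j ∈ S ∖ {j₀,j₁}} C(d j + N² - 1, N² - 1)` (slot `j₀` and the
empty slots contribute factors `≤ 1`). [folklore] -/
theorem isoc_prod_le (h01 : j₀ ≠ j₁) (d : MatIdx (t + 2) → ℤ) :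
    ∏ j, ((Finset.univ.filter (fun v : isoVar t S j₀ j₁ => isoSlot t S j₀ j₁ v = j)).card +
        (d j).toNat - 1).choose (d j).toNat ≤
      ((d j₁).toNat + (t + 2)).choose (t + 2) *
        ∏ j ∈ Finset.univ.filter (fun j : MatIdx (t + 2) => j ∈ S ∧ ¬(j = j₀ ∨ j = j₁)),
          ((d j).toNat + ((t + 2) * (t + 2) - 1)).choose ((t + 2) * (t + 2) - 1) := by
  classical
  refine (Finset.prod_le_prod' fun j _ => isoc_factor_le t h01 d j).trans (le_of_eq ?_)
  rw [Finset.prod_mul_distrib, Finset.prod_ite_eq', if_pos (Finset.mem_univ _),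
    ← Finset.prod_filter]

end Slice

/-! ## The core bound -/

/-- **The isotypic slice bound, binomial core form** (`N = t + 2`, general kept set `S ∋ j₀, j₁`,
general weight `χ`).  A space `W` of degree-`D` row-wise unimodular sandwich invariants supported
on the slots of `S` that are `B`-semi-invariant of weight `χ` has dimension at most
`C(d j₁ + N, N) · ∏_{j ∈ S ∖ {j₀,j₁}} C(d j + N² - 1, N² - 1)`, `d = (-χ)⁺`: the split-scalar slice
projection is injective on `W` (Zariski density, `fr_eq_zero_of_aeval_frProj`), equivariant for
the row tori (`isoProj_isWeightedHomogeneous`), and slice polynomials of row weight `-χ` are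
counted slot by slot (`isoc_finrank_le`).  Sharpens `iso_core` (box count
`(d j₁ + 1)^(N+1) · ∏ (d j + 1)^(N²)`). [folklore: Krylov normal form + torus weights + stars and bars] -/
theorem isoc_core : ∀ (t : ℕ) (S : Set (MatIdx (t + 2))) [DecidablePred (· ∈ S)] (j₀ j₁ : MatIdx (t + 2)), j₀ ≠ j₁ → j₀ ∈ S → j₁ ∈ S → ∀ (χ : Weight (MatIdx (t + 2))) (D : ℕ) (W : Submodule ℂ (MvPolynomial (MatIdx (t + 2) × MatIdx (t + 2)) ℂ)), W ≤ MvPolynomial.homogeneousSubmodule (MatIdx (t + 2) × MatIdx (t + 2)) ℂ D → (∀ G ∈ W, ∀ P Q : Matrix (Fin (t + 2)) (Fin (t + 2)) ℂ, P.det = 1 → Q.det = 1 → MvPolynomial.aeval (sbSubst P Q) G = G) → (∀ G ∈ W, G ∈ MvPolynomial.supported ℂ {p : MatIdx (t + 2) × MatIdx (t + 2) | p.1 ∈ S}) → (∀ G ∈ W, ∀ g : Matrix.GeneralLinearGroup (MatIdx (t + 2)) ℂ, IsUpperTriangular g → MvPolynomial.aeval (R := ℂ) (fun p : MatIdx (t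 + 2) × MatIdx (t + 2) => ∑ l : MatIdx (t + 2), ((g⁻¹ : Matrix.GeneralLinearGroup (MatIdx (t + 2)) ℂ) : Matrix (MatIdx (t + 2)) (MatIdx (t + 2)) ℂ) p.1 l • (MvPolynomial.X (l, p.2) : MvPolynomial (MatIdx (t + 2) × MatIdx (t + 2)) ℂ)) G = weightChar χ g • G) → Module.finrank ℂ ↥W ≤ ((-χ j₁).toNat + (t + 2)).choose (t + 2) * ∏ j ∈ Finset.univ.filter (fun j : MatIdx (t + 2) => j ∈ S ∧ ¬(j = j₀ ∨ j = j₁)), ((-χ j).toNat + ((t + 2) * (t + 2) - 1)).choose ((t + 2) * (t + 2) - 1) := by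
  intro t S _ j₀ j₁ h01 hj₀ hj₁ χ D W hWD hWS hWsupp hWχ
  haveI : Module.Finite ℂ ↥(homogeneousSubmodule (MatIdx (t + 2) × MatIdx (t + 2)) ℂ D) :=
    Module.Finite.iff_fg.mpr (homogeneousSubmodule_fg _ _ _)
  haveI hWfin : Module.Finite ℂ ↥W := Submodule.finiteDimensional_of_le hWD
  let f : MvPolynomial (MatIdx (t + 2) × MatIdx (t + 2)) ℂ →ₗ[ℂ] MvPolynomial (isoVar t S j₀ j₁) ℂ :=
    (aeval (isoProj t S j₀ j₁)).toLinearMap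
  haveI : Module.Finite ℂ ↥(W.map f) :=
    Module.Finite.iff_fg.mpr ((Module.Finite.iff_fg.mp hWfin).map f)
  have hmem : ∀ w : W, f w ∈ W.map f := fun w => Submodule.mem_map_of_mem w.2
  -- injectivity
  have hinj : Function.Injective ((f.domRestrict W).codRestrict (W.map f) hmem) := by
    rw [injective_iff_map_eq_zero]
    intro w hw
    have hw' : aeval (isoProj t S j₀ j₁) (w : MvPolynomial _ ℂ) = 0 := congrArg Subtype.val hw
    refine Subtype.ext (fr_eq_zero_of_aeval_frProj t h01 hj₀ hj₁ _ (hWS w w.2) (hWsupp w w.2) ?_)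
    rw [aeval_frProj_eq_aeval_isoSpec, hw', map_zero]
  -- equivariance
  have himage : W.map f ≤ weightedHomogeneousSubmodule ℂ
      (fun v => (Pi.single (isoSlot t S j₀ j₁ v) (1 : ℤ) : MatIdx (t + 2) → ℤ)) (-χ) := by
    rintro _ ⟨w, hw, rfl⟩
    exact iso_isWeightedHomogeneous_aeval (isoProj_isWeightedHomogeneous t S j₀ j₁)
      (iso_isWeightedHomogeneous_of_semiInvariant χ w (hWχ w hw))
  exact (LinearMap.finrank_le_finrank_of_injective hinj).trans
    ((isoc_finrank_le (isoSlot t S j₀ j₁) (-χ) (W.map f) himage).trans (isoc_prod_le t h01 (-χ)))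



end

end Summit.ValiantsHypothesis.ValiantsHypothesis.Theorems.ValuativeFlip
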